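import Mathlib
import Literature.AlgebraicGeometry.HodgeTheory.FermatShiodaCondition

/-!
# The level-indexed vocabulary of the sibling package: printed supply, ℤ-reachability, level raising, `G_m = 0`, `G^st_m = 0` (`HodgeFermat/Lattice.lean`)

Tree copy of the module `HodgeFermat/Lattice.lean` of the sibling cell's standalone package
`run/shared/lean/pub/pub-hodgefermat/lean/HodgeFermat/` (103 lines, sha256 `f06ec3d097ef033e…`; pub-hodgefermat v0, 2026-08-18, the
«m-INDEXED FAMILY OF STATEMENTS of the package», `GATE.md` l.471 impl D), source lines 20–103 (all): the definitions `Supply`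
(the printed supply of algebraic eigenclasses of level `M` as multisets of residues: pairs `{a, −a}` — linear subspaces —, Hodge
multisets with four elements — Fermat surface —, semi-decomposable Hodge sextuples — type `X¹ × X¹` —, Aoki's standard elements),
`Reach` (ℤ-reachability of a multiset from the supply of its own level), `levelRaise`, `StableReach`, `GapTrivial` (`G_m = 0`),
`StablyGapTrivial` (`G^st_m = 0`), five kernel-decided `example`s and the two bookkeeping theorems `pair_mem_supply`,
`Reach.add_supply`.  Filed because COROLLARY U′ (`HodgeFermatCorollaryUPrime.lean`, HF-G27) concludes `Reach N s` for the all-unit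
Hodge multisets it decomposes into pairs (`reach_of_isSumOfPairs`, `reach_of`, `reach_quadruple_odd`, `reach_odd`, `reach_of_tauP`).
These definitions are the sibling's OWN executable reading of reachability; they are filed verbatim as the sibling's vocabulary and
make no claim about this cell's gap-group records (DOOR.md / RESULTS-FERMAT.md), nor about cycles.
Filed by cell `pub-hfermat`, seat prover-1 gen-5, on the COORDINATOR KEEPER RULING of 2026-08-25 (gem sweep H1: take the
off-gate kernel theorem `thmFstar` through the gate; every form of THEOREM F* is on-gate since 2026-08-25/26, gen-0/2/3/4), as
successor work of the same verbatim-port kind: the sibling's off-gate gate records HF-G27 / HF-G27b / HF-G27c — COROLLARY U′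
(all-unit Hodge multisets with few distinct residues are sums of pairs), its printed-threshold forms U♯, and THEOREM U in
shared-entry form — on top of the landed LEMMA W / THEOREM U / U⁺ / U⁼ chain (`HodgeFermatTheoremU.lean`,
`HodgeFermatLemmaWFourier.lean`, `HodgeFermatTheoremUPlus.lean`, `HodgeFermatTheoremUEq.lean`, `HodgeFermatPropDPrimeNFinal.lean`).
Deviations from the source module, exhaustively: the `import` lines (`Mathlib`; the tree's `Literature.AlgebraicGeometry.HodgeTheory.FermatShiodaCondition`
for the vendored copy `HodgeFermat.Vendored.FermatShiodaCondition` — byte-for-byte that tree file, sha256 `8f58f8d64694…`); this docstring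
(the source's header is a plain `/- … -/` comment placed before its `import` line, l.1–17, quoted below).  Every other line (l.20–103)
is byte-identical to the source.  No `sorry`; axioms = [propext, Classical.choice, Quot.sound].  `decide` only in the source's five small `example`s.
HONEST FRAMING: explicit algebraic cycles for specific Hodge classes on Fermat/Delsarte varieties; residual open instances
listed; no claim on general Hodge.  (This file is arithmetic of CM types / finite combinatorics of the sibling's KR-free
programme; it claims nothing about cycles.)

The header comment of `HodgeFermat/Lattice.lean` (l.1–17), verbatim:

HodgeFermat/Lattice.lean — the m-INDEXED FAMILY OF STATEMENTS of the package (new file, pub-hodgefermat v0, 2026-08-18).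

For every level `M` the four printed families of algebraic eigenclasses on Fermat varieties, as multisets of
residues ("printed supply"), ℤ-reachability of a Hodge multiset from the supply, level raising `s ↦ k•s`, and the
two per-degree statements the census decides:

* `GapTrivial m`        — `G_m = 0`: every Hodge multiset of level `m` is ℤ-reachable at level `m`;
* `StablyGapTrivial m`  — `G^st_m = 0`: every Hodge multiset of level `m` is ℤ-reachable after some level raising.

These are the SAME terms as the `local notation3` lines `Supply[M]`, `Reach[M, s]`, `LevelRaise[k, m, s]`,
`StableReach[m, s]` of the harness skeleton `Summits/HodgeConjecture/HodgeConjecture/Cruxes/HodgeFermatVarieties/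
Lines/cancel_by_any_claim_lattice.lean` (lines 186–225), turned into definitions so that a standalone package can
name them.  Geometric meaning (why reachability gives algebraic cycles) is in `HodgeFermat/Statement.lean`.

References: [Shioda1979PJA] §1; [Aoki1987] Thm 1-1, 1-4, 2-1; [AokiShioda1983] (2.1); [daSilva2021HodgeFermat] §2–3.
-/

open Multiset

namespace HodgeFermat

open Literature.AlgebraicGeometry.HodgeTheory.FermatCharacter

/-- **The printed supply of level `M`** (`⊆ Multiset (ZMod M)`): pairs `{a, -a}` (linear subspaces; Shioda 1979,
Ran 1980 Thm 4.9, Aoki 1987 Thm 1-1); Hodge multisets with `4` elements (Fermat surface, Lefschetz (1,1);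
Aoki–Shioda 1983 (2.1)); semi-decomposable Hodge sextuples (`X¹ × X¹` type; Shioda 1979 PJA §1 (iii)); Aoki's
standard elements `σ_{p,a} = {a, a+d, …, a+(p-1)d} + {-pa}`, `p ∣ M` an odd prime, `d = M/p`, with side
condition `d / gcd(⟨a⟩, d) > 2` (Aoki 1987 Thm 2-1 and pull-backs of primitive ones). -/
def Supply (M : ℕ) : Set (Multiset (ZMod M)) :=
  {s : Multiset (ZMod M) | ∃ a : ZMod M, a ≠ 0 ∧ s = ({a, -a} : Multiset (ZMod M))} ∪
    {s : Multiset (ZMod M) | IsHodgeMultiset s ∧ Multiset.card s = 4} ∪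
    {s : Multiset (ZMod M) | IsHodgeMultiset s ∧ IsSemiDecomposable s} ∪
    {s : Multiset (ZMod M) | ∃ (p : ℕ) (a : ZMod M), p.Prime ∧ p ≠ 2 ∧ p ∣ M ∧
        2 < (M / p) / Nat.gcd (ZMod.val a) (M / p) ∧
        s = Multiset.map (fun j : ℕ => a + (j : ZMod M) * ((M / p : ℕ) : ZMod M)) (Multiset.range p) +
              {-((p : ZMod M) * a)}}

/-- **ℤ-reachability** of `s` from the printed supply of its own level: `s + ΣN = ΣP` as multisets for finite
families `P` (positive part) and `N` (negative part) of supply elements, i.e. the multiplicity vector of `s` lies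
in `L_D(M) = span_ℤ Supply`.  Shioda's `(P_M)`-reachability is the case `N ⊆ pairs`, no standard elements. -/
def Reach (M : ℕ) (s : Multiset (ZMod M)) : Prop :=
  ∃ P N : Multiset (Multiset (ZMod M)),
    (∀ u ∈ P, u ∈ Supply M) ∧ (∀ u ∈ N, u ∈ Supply M) ∧ s + N.sum = P.sum

/-- **Level raising** `s ↦ k • s`: pull-back of characters along `[xᵢ] ↦ [xᵢᵏ] : Xⁿ_{km} → Xⁿ_m`
(representatives multiply by `k`). -/
def levelRaise (k m : ℕ) (s : Multiset (ZMod m)) : Multiset (ZMod (k * m)) :=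
  s.map fun a : ZMod m => ((k * ZMod.val a : ℕ) : ZMod (k * m))

/-- **Stable reachability**: reachable after raising the level by some `k ≥ 1`. -/
def StableReach (m : ℕ) (s : Multiset (ZMod m)) : Prop :=
  ∃ k : ℕ, 0 < k ∧ Reach (k * m) (levelRaise k m s)

/-- **`G_m = 0`** — the gap group `K_Hodge(m) / L_D(m)` vanishes: every Hodge multiset of level `m` is
ℤ-reachable from the printed supply at level `m`.  Decided by the census for `2 ≤ m ≤ 240` (true for 147
degrees, false for 92: `INVENTORY.md`, `GATE.md`). -/
def GapTrivial (m : ℕ) : Prop :=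
  ∀ s : Multiset (ZMod m), IsHodgeMultiset s → Reach m s

/-- **`G^st_m = 0`** — every Hodge multiset of level `m` becomes ℤ-reachable after some level raising
(`m = 33`: at level `66`; `m = 99`: at level `198`).  Implies the Hodge conjecture for `Xⁿ_m` for every `n`
given the printed facts (`Statement.lean`). -/
def StablyGapTrivial (m : ℕ) : Prop :=
  ∀ s : Multiset (ZMod m), IsHodgeMultiset s → StableReach m s

/-! ### Sanity: the vocabulary computes on the decisive instances (kernel-decided) -/

/-- da Silva's class of `X⁴₃₃` (orbit representative used by the census) is a Hodge multiset. -/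
example : IsHodgeMultiset ({7, 10, 13, 19, 22, 28} : Multiset (ZMod 33)) := by
  unfold IsHodgeMultiset mNormSum; decide

/-- … its level-`66` pull-back is `{14, 20, 26, 38, 44, 56}`. -/
example : levelRaise 2 33 ({7, 10, 13, 19, 22, 28} : Multiset (ZMod 33)) =
    ({14, 20, 26, 38, 44, 56} : Multiset (ZMod (2 * 33))) := by
  decide

/-- The generator `γ₃₅ = (1,2,16,17,21,22,30,31)` of `G₃₅ ≅ ℤ/2` is a Hodge multiset of `X⁶₃₅`. -/
example : IsHodgeMultiset ({1, 2, 16, 17, 21, 22, 30, 31} : Multiset (ZMod 35)) := by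
  unfold IsHodgeMultiset mNormSum; decide

/-- A pair lies in the printed supply. -/
theorem pair_mem_supply {M : ℕ} (a : ZMod M) (ha : a ≠ 0) : ({a, -a} : Multiset (ZMod M)) ∈ Supply M :=
  Or.inl (Or.inl (Or.inl ⟨a, ha, rfl⟩))

/-- A semi-decomposable Hodge sextuple lies in the printed supply (here `{1,2,30} + {12,23,31}` at level `33`). -/
example : ({1, 2, 30, 12, 23, 31} : Multiset (ZMod 33)) ∈ Supply 33 :=
  Or.inl (Or.inr ⟨by unfold IsHodgeMultiset mNormSum; decide,
    ⟨{1, 2, 30}, {12, 23, 31}, rfl, rfl, by decide, by decide, by decide⟩⟩)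

/-- Reachability is monotone under juxtaposition with a supply element (bookkeeping lemma used by certificates). -/
theorem Reach.add_supply {M : ℕ} {s u : Multiset (ZMod M)} (hs : Reach M s) (hu : u ∈ Supply M) :
    Reach M (s + u) := by
  obtain ⟨P, N, hP, hN, h⟩ := hs
  refine ⟨u ::ₘ P, N, ?_, hN, ?_⟩
  · intro v hv
    rcases Multiset.mem_cons.mp hv with rfl | hv
    · exact hu
    · exact hP v hv
  · rw [Multiset.sum_cons, add_right_comm, h, add_comm]

end HodgeFermat
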